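import Summits.QuantumFields.YangMills.Theorems.UnitScaleTiltProp7KinvBoundOfInterpolant
import HarnessLib

/-!
# Route `UnitScaleTilt`, crux K1 «MinimiserStabilityRegPr» (stmt-QuantumFields-19200), EX face — K137 STOREY, FILE (K1-fam):
# **THE `m₀` FAMILY (coercivity of `K = Q_kGQ_k†`, L-ONLY CONSTANT AT THE SCALING OF RECORD) FROM THE (K1b-a) INTERPOLANT FAMILY** — the Idx edition of px12 ✓p767561
# `norm_KinvT_le_of_interpolant_rows` (conjunct 2), written in EXACTLY the text the (K2-KNIT)'s Idx edition ✓`Prop7KinvRowOfConjLetters.kinvRow_family_of_coercive_of_conjResolvent` displays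
# as `hKco`: `m₀ L·((cB L∕c₀ L)·ℓ⁻³)·‖c‖² ≤ re⟪c, Q_k(G(Q_k†c))⟫`

Cell `ym3-torus` (HUMAN RULING D-0037; rung R3 = SU(2) YM₃ on T³ — NOT d = 4, NOT infinite volume, NOT a mass gap, NOT Clay).  Width seat `ym3-torus-px10` (gen 13; FREE px after
✓p768275∕✓p768476∕✓p768615∕✓p768818∕✓p769218∕✓p769611∕✓p769862∕✓p770187).  THEOREMS ONLY (0 `def`, 0 `sorry`, default heartbeats); `--supports stmt-QuantumFields-19200 --as helper`; count-neutral.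

THE SCALING (why the member letters are displayed as below).  px13 g15's (K1b-a) F2d ✓∕⧗`exists_transportedInterpolant_of_regPr` gives the transported interpolant `E` with `‖Q_kE c − c‖ ≤ ½‖c‖`
and `‖E c‖ ≤ 45·√((c₀∕cB)ℓ³)·‖c‖` — so `C₁² ∝ (c₀∕cB)ℓ³ =: s⁻¹`; the gradient energy row (s2) is `C_D ∝ s⁻¹` likewise; the coupling window is `a ≤ A·s⁻¹`; the slot row `C_s` and
`C_loc(ε₀) = 32√2·ε₀·648 ≤ 32√2·648` are `O(1)`.  Hence px12's `C₀ = C_D + (C_loc + C_s)C₁² + a(1+θ)² ≤ Ĉ·s⁻¹`, `Ĉ := CD L + (32√2·648 + Cs L)·(C₁ L)² + (9∕4)·A L` (L-only), and the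
coercivity constant `(4C₀)⁻¹ ≥ s∕(4Ĉ)` — the `m₀ L := (4Ĉ)⁻¹` AT THE SCALING `s = (cB∕c₀)ℓ⁻³`, as the (K2-KNIT) Idx edition wants.
THE DISPLAYED FAMILY LETTERS (under `RegPr ρ U₀ → ρ ≤ α L → Λ L i U₀ →`; cap `α` with `α L ≤ 1`): `hpos` (the class at the slot), `hΔs` (the slot is symmetric — ✓`DeltaEta_isSymmetric` at η),
`hslot` (`re⟪v, (Δx − Δ^η)v⟫ ≤ Cs L·‖v‖²`; `0` at η), the coupling window `0 ≤ a L i ≤ A L·((c₀∕cB)ℓ³)`, and the INTERPOLANT FAMILY `hE : ∃ E, (‖Q_kEc − c‖ ≤ ½‖c‖) ∧ (‖Ec‖ ≤ C₁ L·√((c₀∕cB)ℓ³)·‖c‖)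
∧ (Σ_μ‖D_{U₀}(toL2S (Ec)_μ)‖² ≤ CD L·((c₀∕cB)ℓ³)·‖c‖²)` (px13's F2d∕F3 texts with their scalings).
WHAT IS PROVED (ns `Summit.QuantumFields.YangMills.Theorems.Prop7KCoerciveFamilyOfInterpolant`).
* `coercive_mono` — a smaller constant is still a coercivity constant.
* ★★★ `hKco_family_of_interpolant_rows` — the `hKco` FAMILY TEXT of ✓`kinvRow_family_of_coercive_of_conjResolvent` with `m₀ L := (4·(CD L + (32√2·648 + Cs L)·(C₁ L)² + (9∕4)·A L))⁻¹`.
HYP-SAT (★★OWNER №42).  Displayed letters = px12 ✓p767561's hypotheses at the family scalings (class (1), suppliers px13 (K1b-a) F2d∕F3, ✓`DeltaEta_isSymmetric`, the junction's pin); no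
conclusion-shaped letter.  HONEST SCOPE.  One `obtain` + real bookkeeping; nothing of (K1b-a)'s rows, EX or the crux is proved here; the Yang–Mills mass gap is NOT proved.

References: T. Bałaban, CMP **99** (1985) 389–434 [Balaban1985BackgroundPropagators] (Thm 3.3 (3.47) p.399, (3.19) p.393, (3.132) p.422); CMP **98** (1985) 17–51 [Balaban1985Averaging] ((2) p.17).
-/

set_option autoImplicit false

noncomputable section

open scoped BigOperators Matrix.Norms.L2Operator InnerProductSpace ComplexConjugate

namespace Summit.QuantumFields.YangMills.Theorems.Prop7KCoerciveFamilyOfInterpolant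

open Literature.MathematicalPhysics.QuantumFieldTheory.Balaban1983to89
open Literature.MathematicalPhysics.QuantumFieldTheory.Balaban1983to89.T3ContinuumYM3Torus
open Literature.MathematicalPhysics.QuantumFieldTheory.Balaban1983to89.T3Thm1Carrier
open T3SectALandauChart (formComp)
open T3PrintedRegularMinimiser (RegPr)
open B9Eq311L2Pairing (WL2)
open B11Eq103H1Complex (BondL2K)
open Summit.QuantumFields.YangMills.Theorems.Prop7SectET3Transport (periodsT3)
open Summit.QuantumFields.YangMills.Theorems.Prop7SectET3HilbertLetters (W₂ toL2 toL2S DL2)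
open Summit.QuantumFields.YangMills.Theorems.Prop7SectET3WilsonHessian (DeltaEta)
open Summit.QuantumFields.YangMills.Theorems.Prop7SectET3CurvedPropagators (Qk GT PosOnto)
open Summit.QuantumFields.YangMills.Theorems.Prop7KinvBoundOfInterpolant (norm_KinvT_le_of_interpolant_rows)

/-- A coercivity constant may be lowered. [folklore] -/
theorem coercive_mono {C : Type*} [NormedAddCommGroup C] {m m' : ℝ} {f : C → ℝ} (hmm : m' ≤ m) (h : ∀ c : C, m * ‖c‖ ^ 2 ≤ f c) (c : C) : m' * ‖c‖ ^ 2 ≤ f c :=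
  (mul_le_mul_of_nonneg_right hmm (sq_nonneg _)).trans (h c)

/-- ★★★ **THE `m₀` FAMILY FROM THE INTERPOLANT FAMILY** (Idx edition of px12 ✓`norm_KinvT_le_of_interpolant_rows`, conjunct 2).  Cap `α` (`0 < α L ≤ 1`), L-only weights, a member coupling
pinned in `[0, A L·((c₀∕cB)ℓ³)]`, generic slot `Δx L i` and thread `Λ`; displayed family letters `hpos`, `hΔs`, `hslot` (`Cs L ≥ 0`), `hE` (the transported-interpolant package with
`C₁ L·√((c₀∕cB)ℓ³)` and `CD L·((c₀∕cB)ℓ³)`, `CD L > 0`).  THEN the `hKco` family of ✓`kinvRow_family_of_coercive_of_conjResolvent`: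
`m₀ L·((cB L∕c₀ L)·((L:ℝ)^(K−n))⁻¹^3)·‖c‖² ≤ re⟪c, Q_k(G(Q_k†c))⟫` with `m₀ L := (4·(CD L + (32√2·648 + Cs L)·(C₁ L)² + (9∕4)·A L))⁻¹`.
[cite: Balaban1985BackgroundPropagators, Thm 3.3 (3.47) p.399, (3.19) p.393, (3.132) p.422] -/
theorem hKco_family_of_interpolant_rows
    (α : ℕ → ℝ) (hα : ∀ L : ℕ, 1 < L → 0 < α L) (hα1 : ∀ L : ℕ, 1 < L → α L ≤ 1)
    (c₀ cB : ℕ → ℝ) [hc₀ : ∀ L : ℕ, Fact (0 < c₀ L)] [hcB : ∀ L : ℕ, Fact (0 < cB L)] (a : ∀ L : ℕ, Idx L → ℝ) (A : ℕ → ℝ)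
    (ha0 : ∀ (L : ℕ) (i : Idx L), 0 ≤ a L i) (haU : ∀ (L : ℕ), 1 < L → ∀ i : Idx L, a L i ≤ A L * ((c₀ L / cB L) * ((L : ℝ) ^ (i.1.2.2 - i.1.2.1)) ^ 3))
    (Δx : ∀ (L : ℕ) (i : Idx L), GaugeField (i.1.1.P i.1.2.2) 0 (Matrix.specialUnitaryGroup (Fin 2) ℂ) →
      (BondL2K ℂ 3 (periodsT3 i.1.1 i.1.2.2) (c₀ L) W₂ →ₗ[ℂ] BondL2K ℂ 3 (periodsT3 i.1.1 i.1.2.2) (c₀ L) W₂))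
    (Λ : ∀ (L : ℕ) (i : Idx L), GaugeField (i.1.1.P i.1.2.2) 0 (Matrix.specialUnitaryGroup (Fin 2) ℂ) → Prop)
    (C₁ CD Cs : ℕ → ℝ) (hCD : ∀ L, 1 < L → 0 < CD L) (hCs : ∀ L, 1 < L → 0 ≤ Cs L)
    (hpos : ∀ (L : ℕ), 1 < L → ∀ (i : Idx L) (U₀ : GaugeField (i.1.1.P i.1.2.2) 0 (Matrix.specialUnitaryGroup (Fin 2) ℂ)), ∀ ρ : ℝ,
      RegPr i.1.1 i.1.2.1 i.1.2.2 ρ U₀ → ρ ≤ α L → Λ L i U₀ → PosOnto i.1.1 i.1.2.1 i.1.2.2 i.2.2.le (c₀ L) (cB L) (a L i) (Δx L i) U₀)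
    (hΔs : ∀ (L : ℕ), 1 < L → ∀ (i : Idx L) (U₀ : GaugeField (i.1.1.P i.1.2.2) 0 (Matrix.specialUnitaryGroup (Fin 2) ℂ)), ∀ ρ : ℝ,
      RegPr i.1.1 i.1.2.1 i.1.2.2 ρ U₀ → ρ ≤ α L → Λ L i U₀ → (Δx L i U₀).IsSymmetric)
    (hslot : ∀ (L : ℕ), 1 < L → ∀ (i : Idx L) (U₀ : GaugeField (i.1.1.P i.1.2.2) 0 (Matrix.specialUnitaryGroup (Fin 2) ℂ)), ∀ ρ : ℝ,
      RegPr i.1.1 i.1.2.1 i.1.2.2 ρ U₀ → ρ ≤ α L → Λ L i U₀ → ∀ v,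
        RCLike.re ⟪v, (Δx L i U₀ - (DeltaEta i.1.1 i.1.2.1 i.1.2.2 (c₀ L) U₀ : BondL2K ℂ 3 (periodsT3 i.1.1 i.1.2.2) (c₀ L) W₂ →ₗ[ℂ] BondL2K ℂ 3 (periodsT3 i.1.1 i.1.2.2) (c₀ L) W₂)) v⟫_ℂ
          ≤ Cs L * ‖v‖ ^ 2)
    (hE : ∀ (L : ℕ), 1 < L → ∀ (i : Idx L) (U₀ : GaugeField (i.1.1.P i.1.2.2) 0 (Matrix.specialUnitaryGroup (Fin 2) ℂ)), ∀ ρ : ℝ,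
      RegPr i.1.1 i.1.2.1 i.1.2.2 ρ U₀ → ρ ≤ α L → Λ L i U₀ →
      ∃ E : WL2 ℂ (fun _ : PBond (i.1.1.P i.1.2.1) 0 => cB L) W₂ →ₗ[ℂ] BondL2K ℂ 3 (periodsT3 i.1.1 i.1.2.2) (c₀ L) W₂,
        (∀ c, ‖Qk i.1.1 i.1.2.1 i.1.2.2 i.2.2.le (c₀ L) (cB L) U₀ (E c) - c‖ ≤ (1 / 2) * ‖c‖) ∧
        (∀ c, ‖E c‖ ≤ C₁ L * Real.sqrt ((c₀ L / cB L) * ((L : ℝ) ^ (i.1.2.2 - i.1.2.1)) ^ 3) * ‖c‖) ∧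
        (∀ c, ∑ μ : Fin (i.1.1.P i.1.2.2).d, ‖DL2 i.1.1 i.1.2.1 i.1.2.2 (c₀ L) U₀ (toL2S i.1.1 i.1.2.2 (c₀ L) (formComp ((toL2 i.1.1 i.1.2.2 (c₀ L)).symm (E c)) μ))‖ ^ 2
          ≤ CD L * ((c₀ L / cB L) * ((L : ℝ) ^ (i.1.2.2 - i.1.2.1)) ^ 3) * ‖c‖ ^ 2)) :
    ∀ (L : ℕ), 1 < L → ∀ (i : Idx L) (U₀ : GaugeField (i.1.1.P i.1.2.2) 0 (Matrix.specialUnitaryGroup (Fin 2) ℂ)), ∀ ρ : ℝ,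
      RegPr i.1.1 i.1.2.1 i.1.2.2 ρ U₀ → ρ ≤ α L → Λ L i U₀ → ∀ c : WL2 ℂ (fun _ : PBond (i.1.1.P i.1.2.1) 0 => cB L) W₂,
        (4 * (CD L + (32 * Real.sqrt 2 * 648 + Cs L) * C₁ L ^ 2 + 9 / 4 * A L))⁻¹ * ((cB L / c₀ L) * ((L : ℝ) ^ (i.1.2.2 - i.1.2.1))⁻¹ ^ 3) * ‖c‖ ^ 2
          ≤ RCLike.re ⟪c, Qk i.1.1 i.1.2.1 i.1.2.2 i.2.2.le (c₀ L) (cB L) U₀ (GT i.1.1 i.1.2.1 i.1.2.2 i.2.2.le (c₀ L) (cB L) (a L i) (Δx L i) U₀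
            (LinearMap.adjoint (Qk i.1.1 i.1.2.1 i.1.2.2 i.2.2.le (c₀ L) (cB L) U₀) c))⟫_ℂ := by
  intro L hL i U₀ ρ hreg hρ hl c
  have hc₀L : 0 < c₀ L := (hc₀ L).out
  have hcBL : 0 < cB L := (hcB L).out
  have hL0 : (0 : ℝ) < (L : ℝ) := by exact_mod_cast lt_trans zero_lt_one hL
  have hℓ : (0 : ℝ) < (L : ℝ) ^ (i.1.2.2 - i.1.2.1) := pow_pos hL0 _
  have hd : ((i.1.1.P i.1.2.2).d : ℝ) * (2 * 3) ^ (i.1.1.P i.1.2.2).d = 648 := by rw [show (i.1.1.P i.1.2.2).d = 3 from rfl]; norm_num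
  -- the inverse homogeneity factor `t = (c₀∕cB)ℓ³ = s⁻¹`
  set t : ℝ := (c₀ L / cB L) * ((L : ℝ) ^ (i.1.2.2 - i.1.2.1)) ^ 3 with ht
  have ht0 : 0 < t := by rw [ht]; positivity
  have hst : (cB L / c₀ L) * ((L : ℝ) ^ (i.1.2.2 - i.1.2.1))⁻¹ ^ 3 = t⁻¹ := by rw [ht]; field_simp
  -- the member data at the cap `α L`
  have hregα : RegPr i.1.1 i.1.2.1 i.1.2.2 (α L) U₀ := T3PrintedMinimiserExistence.regPr_mono (F := i.1.1) hρ hreg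
  obtain ⟨E, hQE, hE₁, hED⟩ := hE L hL i U₀ ρ hreg hρ hl
  have hmem := fun c' => (norm_KinvT_le_of_interpolant_rows (hpos L hL i U₀ ρ hreg hρ hl) (hΔs L hL i U₀ ρ hreg hρ hl) (hα L hL).le hregα (ha0 L i) E
    (θ := 1 / 2) (by norm_num) le_rfl (hCs L hL) (mul_pos (hCD L hL) ht0) hQE hE₁ hED (hslot L hL i U₀ ρ hreg hρ hl) c').2
  -- the L-only majorant of `C₀`: `C₀ ≤ Ĉ·t`
  set C0 : ℝ := CD L * t + (32 * Real.sqrt 2 * α L * (((i.1.1.P i.1.2.2).d : ℝ) * (2 * 3) ^ (i.1.1.P i.1.2.2).d) + Cs L) * (C₁ L * Real.sqrt t) ^ 2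
    + a L i * (1 + 1 / 2) ^ 2 with hC0
  set Chat : ℝ := CD L + (32 * Real.sqrt 2 * 648 + Cs L) * C₁ L ^ 2 + 9 / 4 * A L with hChat
  have hA0 : 0 ≤ A L := by
    have h := (ha0 L i).trans (haU L hL i)
    rw [← ht] at h
    by_contra hneg
    have : A L * t < 0 := mul_neg_of_neg_of_pos (not_le.mp hneg) ht0
    linarith
  have hC0le : C0 ≤ Chat * t := by
    have h1 : (C₁ L * Real.sqrt t) ^ 2 = C₁ L ^ 2 * t := by rw [mul_pow, Real.sq_sqrt ht0.le]
    have hα0 := (hα L hL).le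
    have hnn : 0 ≤ C₁ L ^ 2 * t := by positivity
    have h648 : 32 * Real.sqrt 2 * α L * 648 ≤ 32 * Real.sqrt 2 * 648 := by
      have h2pos : 0 ≤ 32 * Real.sqrt 2 * 648 := by positivity
      have : 32 * Real.sqrt 2 * α L * 648 = (32 * Real.sqrt 2 * 648) * α L := by ring
      rw [this]
      exact mul_le_of_le_one_right h2pos (hα1 L hL)
    have h2 : (32 * Real.sqrt 2 * α L * 648 + Cs L) * (C₁ L ^ 2 * t) ≤ (32 * Real.sqrt 2 * 648 + Cs L) * (C₁ L ^ 2 * t) :=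
      mul_le_mul_of_nonneg_right (by linarith) hnn
    have h3 : a L i * (1 + 1 / 2) ^ 2 ≤ 9 / 4 * (A L * t) := by
      have := haU L hL i
      rw [← ht] at this
      have e : a L i * (1 + 1 / 2 : ℝ) ^ 2 = 9 / 4 * a L i := by ring
      rw [e]
      exact mul_le_mul_of_nonneg_left this (by norm_num)
    have eC0 : C0 = CD L * t + (32 * Real.sqrt 2 * α L * 648 + Cs L) * (C₁ L ^ 2 * t) + a L i * (1 + 1 / 2) ^ 2 := by rw [hC0, hd, h1]
    have eCh : Chat * t = CD L * t + (32 * Real.sqrt 2 * 648 + Cs L) * (C₁ L ^ 2 * t) + 9 / 4 * (A L * t) := by rw [hChat]; ring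
    rw [eC0, eCh]
    linarith [h2, h3]
  have hC0pos : 0 < C0 := by
    have := hCD L hL; have := hCs L hL; have := ha0 L i; have := (hα L hL).le
    rw [hC0]; positivity
  have hChat0 : 0 < Chat := by
    have := hCD L hL; have := hCs L hL
    rw [hChat]; positivity
  -- `(4Ĉ)⁻¹·t⁻¹ ≤ (4C₀)⁻¹`
  have hmono : (4 * Chat)⁻¹ * t⁻¹ ≤ (4 * C0)⁻¹ := by
    rw [← mul_inv, inv_le_inv₀ (by positivity) (by positivity)]
    linarith [hC0le]
  rw [hst]
  exact coercive_mono hmono hmem c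

end Summit.QuantumFields.YangMills.Theorems.Prop7KCoerciveFamilyOfInterpolant

end
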